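import Summits.KontsevichZagierPeriods.KontsevichZagierPeriods.Theorems.LinRedNormalFormArrangementNormalFormSeparateThreeHHKPoly
import Summits.KontsevichZagierPeriods.KontsevichZagierPeriods.Theorems.LinRedNormalFormArrangementNormalFormSeparateThreeHHKChart
import Summits.KontsevichZagierPeriods.KontsevichZagierPeriods.Theorems.LinRedNormalFormArrangementNormalFormSeparateThreeHHKMonoSplit

/-!
# The numerator of the Taylor split along a nested sector: graded rows and polynomial forms

(Line `janus-bands`, crux `ArrangementNormalForm`, stub `stub_separateHigh`, part `HHKForms` of
the wall-invariant termwise-split lemma `separateThree_hHk` in base dimension `3` with fibres.)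
In coordinates `ξ = x − z₁` centred at a base point `z₁`, the numerator of a terminal piece is
`F(ξ) = ∑ᵢ λ(ξ)^i Qᵢ(ξ₀, ξ₁)` with the linear pole coordinate `λ(ξ) = ξ₂ − l₁ ξ₀ − l₂ ξ₁`
(`lamL`) and real Taylor data `c i m₁ m₂` of the coefficient polynomials (`Fnum`; the Taylor
pieces are `Fpc i`). Along a nested thin sector `ξ = t · e`, `e = d + v (Q + u S)` (`evec`),
each term is homogeneous, so `F(t e) = ∑ₐ t^a Φₐ(e)` with the ROW `Φₐ = Fnum (crow c a)` of total
degree `a` (`Fnum_smul`, `Fnum_crow_smul`); the pieces split the rows termwise. This file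
provides the polynomial bookkeeping of the ray theorem at a direction of type (I):
* `Fnum_ne_zero_of_coef`: a non-zero Taylor coefficient makes `F` a non-zero function
  (`SepHHK.lam_indep` + two-variable coefficient extraction);
* `Pline`, `PP`: the restriction of `F` to a line, resp. to the chart directions `e(v, u)`, as
  honest (bivariate) polynomials, with their evaluation formulas;
* `PP_ne_zero` (registered as `separateThreeHHK_forms`): for a homogeneous non-zero `F` and a
  frame `d, Q, S` of `ℝ³`, the bivariate polynomial `(v, u) ↦ F(d + v (Q + u S))` is non-zero —
  the input of the dyadic lower bound `SepHHK.lower_dyadic₂`.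
-/

noncomputable section

open Set Polynomial
open scoped Polynomial.Bivariate

namespace Summit.KontsevichZagierPeriods.ArrangementNormalForm.JanusBands

namespace SepHHK

open SepTwo

variable {D : ℕ}

/-! ### The numerator in centred coordinates -/

/-- The linear pole coordinate `λ(e) = e₂ − (l₁ e₀ + l₂ e₁)`. -/
def lamL (l₁ l₂ : ℝ) (e : Fin 3 → ℝ) : ℝ := e 2 - (l₁ * e 0 + l₂ * e 1)

/-- The direction of the nested sector: `e = d + v (Q + u S)`. -/
def evec (d Q S : Fin 3 → ℝ) (v u : ℝ) : Fin 3 → ℝ := fun k => d k + v * (Q k + u * S k)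

/-- One term of the numerator. -/
def nterm (l₁ l₂ : ℝ) (c : Coef₃ D) (i m₁ m₂ : Fin (D + 1)) (ξ : Fin 3 → ℝ) : ℝ :=
  c i m₁ m₂ * lamL l₁ l₂ ξ ^ (i : ℕ) * ξ 0 ^ (m₁ : ℕ) * ξ 1 ^ (m₂ : ℕ)

/-- The Taylor piece `i` of the numerator: `λ(ξ)^i Qᵢ(ξ₀, ξ₁)`. -/
def Fpc (l₁ l₂ : ℝ) (c : Coef₃ D) (i : Fin (D + 1)) (ξ : Fin 3 → ℝ) : ℝ :=
  ∑ m₁, ∑ m₂, nterm l₁ l₂ c i m₁ m₂ ξ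

/-- The numerator `F(ξ) = ∑ᵢ λ(ξ)^i Qᵢ(ξ₀, ξ₁)`. -/
def Fnum (l₁ l₂ : ℝ) (c : Coef₃ D) (ξ : Fin 3 → ℝ) : ℝ := ∑ i, Fpc l₁ l₂ c i ξ

/-- The total degree of a term. -/
def tdeg3 (i m₁ m₂ : Fin (D + 1)) : ℕ := (i : ℕ) + m₁ + m₂

/-- The Taylor data of the row of total degree `a`. -/
def crow (c : Coef₃ D) (a : ℕ) : Coef₃ D :=
  fun i m₁ m₂ => if tdeg3 i m₁ m₂ = a then c i m₁ m₂ else 0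

/-- The pole coordinate is linear. -/
theorem lamL_add_smul (l₁ l₂ : ℝ) (ξ η : Fin 3 → ℝ) (r : ℝ) :
    lamL l₁ l₂ (ξ + r • η) = lamL l₁ l₂ ξ + r * lamL l₁ l₂ η := by
  simp only [lamL, Pi.add_apply, Pi.smul_apply, smul_eq_mul]; ring

/-- The pole coordinate is homogeneous. -/
theorem lamL_smul (l₁ l₂ : ℝ) (ξ : Fin 3 → ℝ) (r : ℝ) : lamL l₁ l₂ (r • ξ) = r * lamL l₁ l₂ ξ := by
  simp only [lamL, Pi.smul_apply, smul_eq_mul]; ring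

/-- The direction vector in vector form. -/
theorem evec_eq (d Q S : Fin 3 → ℝ) (v u : ℝ) : evec d Q S v u = d + v • Q + (v * u) • S := by
  funext k; simp only [evec, Pi.add_apply, Pi.smul_apply, smul_eq_mul]; ring

/-- The point of the nested sector is `z₁ + t e`. -/
theorem npt_eq (z₁ d Q S : Fin 3 → ℝ) (t v u : ℝ) :
    npt z₁ d Q S t v u = z₁ + t • evec d Q S v u := by
  funext k; simp only [npt, evec, Pi.add_apply, Pi.smul_apply, smul_eq_mul]

/-- Terms are homogeneous of their total degree. -/
theorem nterm_smul (l₁ l₂ : ℝ) (c : Coef₃ D) (i m₁ m₂ : Fin (D + 1)) (ξ : Fin 3 → ℝ) (r : ℝ) :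
    nterm l₁ l₂ c i m₁ m₂ (r • ξ) = r ^ tdeg3 i m₁ m₂ * nterm l₁ l₂ c i m₁ m₂ ξ := by
  simp only [nterm, lamL_smul, Pi.smul_apply, smul_eq_mul, mul_pow, tdeg3, pow_add]
  ring

/-- Degrees are bounded by `3D`. -/
theorem tdeg3_lt (i m₁ m₂ : Fin (D + 1)) : tdeg3 i m₁ m₂ < 3 * D + 1 := by
  unfold tdeg3; omega

/-- **The pieces along a ray are polynomials in `t` whose coefficients are the rows.** -/
theorem Fpc_smul (l₁ l₂ : ℝ) (c : Coef₃ D) (i : Fin (D + 1)) (ξ : Fin 3 → ℝ) (t : ℝ) :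
    Fpc l₁ l₂ c i (t • ξ) = ∑ a ∈ Finset.range (3 * D + 1), t ^ a * Fpc l₁ l₂ (crow c a) i ξ := by
  have h : ∀ (a : ℕ) (m₁ m₂ : Fin (D + 1)), t ^ a * nterm l₁ l₂ (crow c a) i m₁ m₂ ξ =
      if tdeg3 i m₁ m₂ = a then t ^ a * nterm l₁ l₂ c i m₁ m₂ ξ else 0 := by
    intro a m₁ m₂
    unfold nterm crow
    split_ifs <;> ring
  symm
  calc ∑ a ∈ Finset.range (3 * D + 1), t ^ a * Fpc l₁ l₂ (crow c a) i ξ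
      = ∑ a ∈ Finset.range (3 * D + 1), ∑ m₁ : Fin (D + 1), ∑ m₂ : Fin (D + 1),
          t ^ a * nterm l₁ l₂ (crow c a) i m₁ m₂ ξ := by
        refine Finset.sum_congr rfl fun a _ => ?_
        unfold Fpc
        rw [Finset.mul_sum]
        exact Finset.sum_congr rfl fun m₁ _ => Finset.mul_sum _ _ _
    _ = ∑ m₁ : Fin (D + 1), ∑ a ∈ Finset.range (3 * D + 1), ∑ m₂ : Fin (D + 1),
          t ^ a * nterm l₁ l₂ (crow c a) i m₁ m₂ ξ := Finset.sum_comm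
    _ = ∑ m₁ : Fin (D + 1), ∑ m₂ : Fin (D + 1), ∑ a ∈ Finset.range (3 * D + 1),
          t ^ a * nterm l₁ l₂ (crow c a) i m₁ m₂ ξ :=
        Finset.sum_congr rfl fun m₁ _ => Finset.sum_comm
    _ = ∑ m₁ : Fin (D + 1), ∑ m₂ : Fin (D + 1), nterm l₁ l₂ c i m₁ m₂ (t • ξ) := by
        refine Finset.sum_congr rfl fun m₁ _ => Finset.sum_congr rfl fun m₂ _ => ?_
        simp_rw [h]
        rw [Finset.sum_ite_eq, if_pos (Finset.mem_range.2 (tdeg3_lt i m₁ m₂)), nterm_smul]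
    _ = Fpc l₁ l₂ c i (t • ξ) := rfl

/-- **The numerator along a ray is a polynomial in `t` whose coefficients are the rows.** -/
theorem Fnum_smul (l₁ l₂ : ℝ) (c : Coef₃ D) (ξ : Fin 3 → ℝ) (t : ℝ) :
    Fnum l₁ l₂ c (t • ξ) = ∑ a ∈ Finset.range (3 * D + 1), t ^ a * Fnum l₁ l₂ (crow c a) ξ := by
  unfold Fnum
  calc ∑ i : Fin (D + 1), Fpc l₁ l₂ c i (t • ξ)
      = ∑ i : Fin (D + 1), ∑ a ∈ Finset.range (3 * D + 1), t ^ a * Fpc l₁ l₂ (crow c a) i ξ :=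
        Finset.sum_congr rfl fun i _ => Fpc_smul l₁ l₂ c i ξ t
    _ = ∑ a ∈ Finset.range (3 * D + 1), ∑ i : Fin (D + 1), t ^ a * Fpc l₁ l₂ (crow c a) i ξ :=
        Finset.sum_comm
    _ = _ := Finset.sum_congr rfl fun a _ => (Finset.mul_sum _ _ _).symm

/-- Rows are homogeneous. -/
theorem Fnum_crow_smul (l₁ l₂ : ℝ) (c : Coef₃ D) (a : ℕ) (ξ : Fin 3 → ℝ) (r : ℝ) :
    Fnum l₁ l₂ (crow c a) (r • ξ) = r ^ a * Fnum l₁ l₂ (crow c a) ξ := by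
  unfold Fnum Fpc
  simp_rw [Finset.mul_sum]
  refine Finset.sum_congr rfl fun i _ => Finset.sum_congr rfl fun m₁ _ =>
    Finset.sum_congr rfl fun m₂ _ => ?_
  rw [nterm_smul]
  unfold nterm crow
  split_ifs with h
  · rw [h]
  · ring

/-- Rows of rows. -/
theorem crow_crow (c : Coef₃ D) (a : ℕ) : crow (crow c a) a = crow c a := by
  funext i m₁ m₂; unfold crow; split_ifs <;> rfl

/-- The pieces as a polynomial in `t` over `Fin (3D + 1)`. -/
theorem Fpc_smul_pev (l₁ l₂ : ℝ) (c : Coef₃ D) (i : Fin (D + 1)) (ξ : Fin 3 → ℝ) (t : ℝ) :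
    Fpc l₁ l₂ c i (t • ξ) = pev (fun a : Fin (3 * D + 1) => Fpc l₁ l₂ (crow c a) i ξ) t := by
  rw [Fpc_smul, pev, ← Fin.sum_univ_eq_sum_range (fun a => t ^ a * Fpc l₁ l₂ (crow c a) i ξ)]
  exact Finset.sum_congr rfl fun a _ => mul_comm _ _

/-- The numerator as a polynomial in `t` over `Fin (3D + 1)`. -/
theorem Fnum_smul_pev (l₁ l₂ : ℝ) (c : Coef₃ D) (ξ : Fin 3 → ℝ) (t : ℝ) :
    Fnum l₁ l₂ c (t • ξ) = pev (fun a : Fin (3 * D + 1) => Fnum l₁ l₂ (crow c a) ξ) t := by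
  rw [Fnum_smul, pev, ← Fin.sum_univ_eq_sum_range (fun a => t ^ a * Fnum l₁ l₂ (crow c a) ξ)]
  exact Finset.sum_congr rfl fun a _ => mul_comm _ _

/-- The pieces are continuous. -/
theorem continuous_Fpc (l₁ l₂ : ℝ) (c : Coef₃ D) (i : Fin (D + 1)) : Continuous (Fpc l₁ l₂ c i) := by
  unfold Fpc nterm lamL
  fun_prop

/-- The numerator is continuous. -/
theorem continuous_Fnum (l₁ l₂ : ℝ) (c : Coef₃ D) : Continuous (Fnum l₁ l₂ c) := by
  unfold Fnum
  exact continuous_finsetSum _ fun i _ => continuous_Fpc l₁ l₂ c i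

/-- The direction vector is continuous in `(v, u)`. -/
theorem continuous_evec (d Q S : Fin 3 → ℝ) : Continuous fun p : ℝ × ℝ => evec d Q S p.1 p.2 := by
  refine continuous_pi fun k => ?_
  simp only [evec]
  fun_prop

/-! ### A non-zero coefficient makes a non-zero function -/

/-- Two-variable coefficient extraction. -/
theorem coef2_eq_zero_of_forall (γ : Fin (D + 1) → Fin (D + 1) → ℝ)
    (h : ∀ w₀ w₁ : ℝ, ∑ m₁, ∑ m₂, γ m₁ m₂ * w₀ ^ (m₁ : ℕ) * w₁ ^ (m₂ : ℕ) = 0) : γ = 0 := by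
  have h1 : ∀ w₀ : ℝ, (fun m₂ => ∑ m₁, γ m₁ m₂ * w₀ ^ (m₁ : ℕ)) = 0 := by
    intro w₀
    refine coef_eq_zero_of_forall _ Set.infinite_univ fun w₁ _ => ?_
    rw [← h w₀ w₁, Finset.sum_comm]
    simp_rw [Finset.sum_mul]
  funext m₁ m₂
  have h2 : (fun m₁ => γ m₁ m₂) = 0 := by
    refine coef_eq_zero_of_forall _ Set.infinite_univ fun w₀ _ => ?_
    have := congr_fun (h1 w₀) m₂
    simpa using this
  exact congr_fun h2 m₁

/-- **A non-zero Taylor coefficient makes the numerator a non-zero function.** -/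
theorem Fnum_ne_zero_of_coef (l₁ l₂ : ℝ) (c : Coef₃ D) (hc : c ≠ 0) :
    ∃ ξ : Fin 3 → ℝ, Fnum l₁ l₂ c ξ ≠ 0 := by
  by_contra hall
  push Not at hall
  apply hc
  -- `F = ∑ᵢ λ^i hᵢ(ξ′)` with `hᵢ(w) = ∑ c i m w₀^{m₁} w₁^{m₂}`
  set h : Fin (D + 1) → (Fin 2 → ℝ) → ℝ :=
    fun i w => ∑ m₁, ∑ m₂, c i m₁ m₂ * w 0 ^ (m₁ : ℕ) * w 1 ^ (m₂ : ℕ) with hh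
  have H : ∀ ξ : Fin 3 → ℝ,
      ∑ i : Fin (D + 1), h i ![ξ 0, ξ 1] * (ξ 2 - (l₁ * ξ 0 + l₂ * ξ 1)) ^ (i : ℕ) = 0 := by
    intro ξ
    rw [← hall ξ]
    unfold Fnum Fpc nterm lamL
    refine Finset.sum_congr rfl fun i _ => ?_
    simp only [hh, Matrix.cons_val_zero, Matrix.cons_val_one, Finset.sum_mul]
    refine Finset.sum_congr rfl fun m₁ _ => Finset.sum_congr rfl fun m₂ _ => ?_
    ring
  funext i m₁ m₂
  have hi : ∀ w, h i w = 0 := lam_indep h l₁ l₂ H i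
  have h0 := coef2_eq_zero_of_forall (c i) (fun w₀ w₁ => by
    have := hi ![w₀, w₁]
    simpa [hh] using this)
  exact congr_fun (congr_fun h0 m₁) m₂

/-! ### The numerator along a line and along the chart directions, as polynomials -/

/-- The restriction of the numerator to the line `ξ + r d′`, as a polynomial in `r`. -/
def Pline (l₁ l₂ : ℝ) (c : Coef₃ D) (ξ d' : Fin 3 → ℝ) : ℝ[X] :=
  ∑ i : Fin (D + 1), ∑ m₁ : Fin (D + 1), ∑ m₂ : Fin (D + 1), C (c i m₁ m₂) *
    (C (lamL l₁ l₂ ξ) + C (lamL l₁ l₂ d') * X) ^ (i : ℕ) *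
    (C (ξ 0) + C (d' 0) * X) ^ (m₁ : ℕ) * (C (ξ 1) + C (d' 1) * X) ^ (m₂ : ℕ)

/-- **Evaluation of the line polynomial.** -/
theorem eval_Pline (l₁ l₂ : ℝ) (c : Coef₃ D) (ξ d' : Fin 3 → ℝ) (r : ℝ) :
    (Pline l₁ l₂ c ξ d').eval r = Fnum l₁ l₂ c (ξ + r • d') := by
  unfold Pline Fnum Fpc nterm
  simp only [eval_finsetSum, eval_mul, eval_pow, eval_add, eval_C, eval_X, lamL_add_smul,
    Pi.add_apply, Pi.smul_apply, smul_eq_mul]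
  refine Finset.sum_congr rfl fun i _ => Finset.sum_congr rfl fun m₁ _ =>
    Finset.sum_congr rfl fun m₂ _ => ?_
  ring

/-- **The line principle.** If the numerator vanishes at `ξ + r d′` for all `r` in an infinite
set, it vanishes on the whole line. -/
theorem Fnum_line_zero (l₁ l₂ : ℝ) (c : Coef₃ D) (ξ d' : Fin 3 → ℝ) {T : Set ℝ}
    (hT : T.Infinite) (h : ∀ r ∈ T, Fnum l₁ l₂ c (ξ + r • d') = 0) (r : ℝ) :
    Fnum l₁ l₂ c (ξ + r • d') = 0 := by
  have hP : Pline l₁ l₂ c ξ d' = 0 := by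
    refine Polynomial.eq_zero_of_infinite_isRoot _ (hT.mono fun s hs => ?_)
    show (Pline l₁ l₂ c ξ d').IsRoot s
    rw [IsRoot.def, eval_Pline, h s hs]
  rw [← eval_Pline, hP, eval_zero]

/-- One coordinate `e(v, u)ₖ = dₖ + v (Qₖ + u Sₖ)` as a bivariate polynomial (`v` inner). -/
def Ecoord (d Q S : Fin 3 → ℝ) (k : Fin 3) : ℝ[X][Y] :=
  C (C (d k) + C (Q k) * X) + C (C (S k) * X) * Polynomial.X

/-- The numerator along the chart directions, as a bivariate polynomial in `(v, u)`. -/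
def PP (l₁ l₂ : ℝ) (c : Coef₃ D) (d Q S : Fin 3 → ℝ) : ℝ[X][Y] :=
  ∑ i : Fin (D + 1), ∑ m₁ : Fin (D + 1), ∑ m₂ : Fin (D + 1), C (C (c i m₁ m₂)) *
    (Ecoord d Q S 2 - (C (C l₁) * Ecoord d Q S 0 + C (C l₂) * Ecoord d Q S 1)) ^ (i : ℕ) *
    Ecoord d Q S 0 ^ (m₁ : ℕ) * Ecoord d Q S 1 ^ (m₂ : ℕ)

/-- Evaluation of a coordinate. -/
theorem evalEval_Ecoord (d Q S : Fin 3 → ℝ) (k : Fin 3) (v u : ℝ) :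
    (Ecoord d Q S k).evalEval v u = evec d Q S v u k := by
  simp only [Ecoord, evalEval, eval_add, eval_mul, eval_C, eval_X, evec]
  ring

/-- **Evaluation of the chart polynomial.** -/
theorem evalEval_PP (l₁ l₂ : ℝ) (c : Coef₃ D) (d Q S : Fin 3 → ℝ) (v u : ℝ) :
    (PP l₁ l₂ c d Q S).evalEval v u = Fnum l₁ l₂ c (evec d Q S v u) := by
  have hE := evalEval_Ecoord d Q S
  unfold PP Fnum Fpc nterm
  rw [evalEval_finsetSum]
  refine Finset.sum_congr rfl fun i _ => ?_
  rw [evalEval_finsetSum]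
  refine Finset.sum_congr rfl fun m₁ _ => ?_
  rw [evalEval_finsetSum]
  refine Finset.sum_congr rfl fun m₂ _ => ?_
  simp only [evalEval_mul, evalEval_pow, evalEval_sub, evalEval_add, evalEval_C, eval_C, hE, lamL]

/-! ### Frames and the non-vanishing of the chart polynomial -/

/-- Every vector has coordinates in a frame. -/
theorem exists_coords {d Q S : Fin 3 → ℝ} (hdet : det3 d Q S ≠ 0) (ξ : Fin 3 → ℝ) :
    ∃ α β γ : ℝ, ξ = α • d + β • Q + γ • S := by
  classical
  set f := Matrix.toLin' (fmat d Q S) with hf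
  have hinj : Function.Injective f := by
    intro w w' h
    have h0 : (fmat d Q S).mulVec (w - w') = 0 := by
      rw [Matrix.mulVec_sub, sub_eq_zero]
      exact h
    by_contra hne
    exact hdet ((Matrix.exists_mulVec_eq_zero_iff).1 ⟨w - w', sub_ne_zero.2 hne, h0⟩)
  obtain ⟨w, hw⟩ := (LinearMap.injective_iff_surjective.1 hinj) ξ
  refine ⟨w 0, w 1, w 2, ?_⟩
  funext k
  have hk := congr_fun hw k
  rw [hf, Matrix.toLin'_apply, fmat_mulVec] at hk
  simp only [Pi.add_apply, Pi.smul_apply, smul_eq_mul]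
  linarith

/-- **The chart polynomial of a homogeneous non-zero numerator is non-zero.** See the module
docstring. -/
theorem PP_ne_zero (l₁ l₂ : ℝ) (c : Coef₃ D) {d Q S : Fin 3 → ℝ} (hdet : det3 d Q S ≠ 0)
    (a : ℕ) (hhom : ∀ (r : ℝ) (ξ : Fin 3 → ℝ), Fnum l₁ l₂ c (r • ξ) = r ^ a * Fnum l₁ l₂ c ξ)
    (hne : ∃ ξ, Fnum l₁ l₂ c ξ ≠ 0) : PP l₁ l₂ c d Q S ≠ 0 := by
  intro hPP
  obtain ⟨ξ₀, hξ₀⟩ := hne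
  apply hξ₀
  have hH : ∀ v u : ℝ, Fnum l₁ l₂ c (evec d Q S v u) = 0 := fun v u => by
    rw [← evalEval_PP, hPP, evalEval_zero]
  -- Step 1: vanishing on the plane `d + span (Q, S)` off the line `v = 0`
  have h1 : ∀ v : ℝ, v ≠ 0 → ∀ s : ℝ, Fnum l₁ l₂ c (d + s • S + v • Q) = 0 := by
    intro v hv s
    have := hH v (s / v)
    rw [evec_eq, mul_div_cancel₀ _ hv] at this
    rwa [add_right_comm] at this
  -- Step 2: vanishing on the whole plane (line principle in `v`)
  have h2 : ∀ s v : ℝ, Fnum l₁ l₂ c (d + s • S + v • Q) = 0 := by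
    intro s v
    have hinf : ({v : ℝ | v ≠ 0}).Infinite := by
      have : ({v : ℝ | v ≠ 0}) = Set.univ \ {0} := by ext; simp
      rw [this]; exact Set.infinite_univ.sdiff (Set.finite_singleton 0)
    exact Fnum_line_zero l₁ l₂ c (d + s • S) Q hinf (fun v hv => h1 v hv s) v
  -- Step 3: vanishing on the cone over the plane (homogeneity)
  have h3 : ∀ α β γ : ℝ, α ≠ 0 → Fnum l₁ l₂ c (α • d + β • Q + γ • S) = 0 := by
    intro α β γ hα
    have he : α • d + β • Q + γ • S = α • (d + (γ / α) • S + (β / α) • Q) := by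
      rw [smul_add, smul_add, smul_smul, smul_smul, mul_div_cancel₀ _ hα, mul_div_cancel₀ _ hα]
      abel
    rw [he, hhom, h2, mul_zero]
  -- Step 4: vanishing on the plane `α = 0` (line principle along `d`)
  have h4 : ∀ β γ : ℝ, Fnum l₁ l₂ c (β • Q + γ • S) = 0 := by
    intro β γ
    have hinf : ({r : ℝ | r ≠ 0}).Infinite := by
      have : ({r : ℝ | r ≠ 0}) = Set.univ \ {0} := by ext; simp
      rw [this]; exact Set.infinite_univ.sdiff (Set.finite_singleton 0)
    have h := Fnum_line_zero l₁ l₂ c (β • Q + γ • S) d hinf (fun r hr => by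
      have := h3 r β γ hr
      rwa [show r • d + β • Q + γ • S = β • Q + γ • S + r • d by abel] at this) 0
    rwa [zero_smul, add_zero] at h
  -- Step 5: every vector has frame coordinates
  obtain ⟨α, β, γ, rfl⟩ := exists_coords hdet ξ₀
  by_cases hα : α = 0
  · rw [hα, zero_smul, zero_add]; exact h4 β γ
  · exact h3 α β γ hα

end SepHHK

/-- **The chart polynomial of a homogeneous non-zero numerator is non-zero** (registered part of
`stub_separateHigh`, base dimension `3` with fibres; consequence of `SepHHK.PP_ne_zero`): if the
numerator `F(ξ) = ∑ᵢ λ(ξ)^i Qᵢ(ξ₀, ξ₁)` with Taylor data `c` is homogeneous of degree `a` and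
has a non-zero coefficient, then for every frame `d, Q, S` of `ℝ³` the function
`(v, u) ↦ F(d + v (Q + u S))` does not vanish identically. -/
theorem separateThreeHHK_forms (D : ℕ) (l₁ l₂ : ℝ) (c : Fin (D + 1) → Fin (D + 1) → Fin (D + 1) → ℝ) (hc : c ≠ 0) (d Q S : Fin 3 → ℝ) (hdet : SepHHK.det3 d Q S ≠ 0) (a : ℕ) (hhom : ∀ (r : ℝ) (ξ : Fin 3 → ℝ), SepHHK.Fnum l₁ l₂ c (r • ξ) = r ^ a * SepHHK.Fnum l₁ l₂ c ξ) : ∃ v u : ℝ, SepHHK.Fnum l₁ l₂ c (fun k => d k + v * (Q k + u * S k)) ≠ 0 := by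
  have h := SepHHK.PP_ne_zero l₁ l₂ c hdet a hhom (SepHHK.Fnum_ne_zero_of_coef l₁ l₂ c hc)
  by_contra hall
  push Not at hall
  apply h
  refine Polynomial.ext fun k => Polynomial.funext fun v => ?_
  have hz : ∀ u, (SepHHK.PP l₁ l₂ c d Q S).evalEval v u = 0 := fun u => by
    rw [SepHHK.evalEval_PP]; exact hall v u
  have hp : Polynomial.map (Polynomial.evalRingHom v) (SepHHK.PP l₁ l₂ c d Q S) = 0 := by
    refine Polynomial.funext fun u => ?_
    rw [Polynomial.eval_map, Polynomial.eval₂_evalRingHom, Polynomial.eval_zero]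
    exact hz u
  have := congrArg (fun p => Polynomial.coeff p k) hp
  simpa [Polynomial.coeff_map] using this

end Summit.KontsevichZagierPeriods.ArrangementNormalForm.JanusBands
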